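import Summits.CriticalPhenomena.PercolationContinuityZ3.Theorems.PercNearOneGluingNoHeavyLowerTailSahiE3DeterminedMeetFKG
import Summits.CriticalPhenomena.PercolationContinuityZ3.Theorems.PercNearOneGluingNoHeavyLowerTailSahiE3PrincipalMeetFKG
import Summits.CriticalPhenomena.PercolationContinuityZ3.Theorems.PercNearOneGluingNoHeavyLowerTailSahiC3CubeFunctions
import Literature.Combinatorics.Sahi2008.Marginals
import Mathlib.Tactic.Linarith
import Mathlib.Tactic.Ring
import HarnessLib
import HarnessLib.Audit

/-!
# `NoHeavyLowerTail` (crux stmt-CriticalPhenomena-4575), Sahi programme P4 (Holley / monotone coupling):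
# an UNCONDITIONAL class for Sahi's `C₃` under every FKG measure on a cube — a pairwise intersection depending on ≤ 3 coordinates

Support file (cell `prim-l12`, seat P4; `--supports stmt-CriticalPhenomena-4575`).  No named facts, no sorries; standard axioms.

## What is proved

1. TRANSFER ALONG A LATTICE QUOTIENT (`latticeE3_preim`, `latticeE3_nonneg_of_inter_determined_of_quotient`).  For a surjective map
   `G : α → γ` of finite distributive lattices preserving `⊓` and `⊔`, whose kernel is "agreement below `w`"
   (`G x = G y ↔ x ⊓ w = y ⊓ w`), the `w`-determined up-sets of `α` are exactly the preimages of up-sets of `γ`, and Sahi's functional of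
   a preimage triple under `μ` is the functional of the triple under the push-forward weight `G_* μ`
   (`Literature.Combinatorics.Sahi2008.pushWeight`, log-supermodular again by Karlin–Rinott / Ahlswede–Daykin, tree
   `fkgCondition_pushWeight`).  With the locality theorem `SahiE3DeterminedMeetFKG.latticeE3_nonneg_of_inter_determined_of_cylinders`:
   **`C₃` on `(γ, G_* μ)` implies `C₃` on `(α, μ)` for every up-set triple whose last two members have a `w`-determined intersection.**
2. THE CUBE CLASS (`latticeE3_nonneg_cube_of_inter_determined_three`).  For EVERY nonnegative log-supermodular weight `μ` on a cube
   `ι → Bool` (`ι` finite), all up-sets `U, A, B`, and three coordinates `e : Fin 3 → ι` (injective) such that membership in `A ∩ B`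
   depends only on the coordinates `e 0, e 1, e 2`:  `0 ≤ latticeE3 μ U A B`.  Discharge of the hypothesis: the push-forward to
   `Fin 3 → Bool` is FKG and the Sahi cell's theorem `SahiC3Cube.latticeE3_nonneg_cube_three` (Sahi's `C₃` on `{0,1}³` for every FKG
   weight) applies.  This is the FKG-measure version of the seat's product-measure class `…SahiE3JuntaMeetSmall` (gen 3, "≤ 3
   coordinates", via Kahn-form certificates) and is new: the printed FKG results are Sahi's `|X| ≤ 2` [Sahi2008, Prop. 15] and the
   principal-slot class [Sahi2008, Thm. 2; Blinovsky 2013]; here `ι` is arbitrary and only ONE pairwise intersection is constrained.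
   (By symmetry of `E₃` the constrained intersection may be any of the three; variants `…₁₂/₁₃`.)
3. MONOTONE FUNCTIONS IN THE FREE SLOT and SAHI'S OWN FUNCTIONAL (`latticeE3fun_eq_sahiE_three`: for a probability weight
   `latticeE3fun μ f g h = sahiE μ 3 ![f,g,h]`, the Literature functional of `SahiConjecture 3`; `sahiE_three_nonneg_…` versions for
   `IsFKGMeasure μ`) — (`latticeE3fun_nonneg_of_forall_upperSet₁`, first-slot layer cake with the Sahi cell's
   `SahiC3Cube.sum_mul_nonneg_of_upperSet`): all of the above with the unconstrained slot `U` replaced by any nonnegative monotone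
   function `u` (`latticeE3fun μ u 1_A 1_B ≥ 0`): `latticeE3fun_nonneg_of_inter_determined`, `latticeE3fun_nonneg_cube_of_inter_determined_three`.
-/

namespace Summit.CriticalPhenomena.PercolationContinuityZ3.Theorems.SahiE3DeterminedMeetFKG

open Finset Literature.Probability.LatticeModels
open Literature.Combinatorics.Sahi2008 (pushWeight pushWeight_apply pushWeight_nonneg fkgCondition_pushWeight sum_pushWeight)
open Summit.CriticalPhenomena.PercolationContinuityZ3.Theorems.SahiE3PrincipalMeetFKG (latticeE3_comm₁₂ latticeE3_comm₂₃)

/-! ### Transfer of `latticeE3` along a map -/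

section Transfer

variable {α γ : Type*} [Fintype α] [DecidableEq α] [Fintype γ] [DecidableEq γ]

/-- The preimage `{x | G x ∈ S}` of a finite set. [this work] -/
def preim (G : α → γ) (S : Finset γ) : Finset α := univ.filter fun x => G x ∈ S

omit [DecidableEq α] [Fintype γ] in
/-- Membership in the preimage. [this work] -/
theorem mem_preim {G : α → γ} {S : Finset γ} {x : α} : x ∈ preim G S ↔ G x ∈ S := by
  simp [preim]

omit [Fintype γ] in
/-- Preimages commute with intersections. [this work] -/
theorem preim_inter (G : α → γ) (S T : Finset γ) : preim G (S ∩ T) = preim G S ∩ preim G T := by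
  ext x
  simp [preim]

omit [DecidableEq α] in
/-- The preimage of everything is everything. [this work] -/
theorem preim_univ (G : α → γ) : preim G (univ : Finset γ) = univ := by
  ext x
  simp [preim]

omit [DecidableEq α] [Fintype γ] in
/-- **Mass of a preimage = push-forward mass**: `m_μ(G⁻¹ S) = m_{G_* μ}(S)`. [this work] -/
theorem mass_preim (μ : α → ℝ) (G : α → γ) (S : Finset γ) : mass μ (preim G S) = mass (pushWeight μ G) S := by
  unfold mass preim
  simp only [pushWeight_apply]
  rw [Finset.sum_comm, Finset.sum_filter]
  refine Finset.sum_congr rfl fun x _ => ?_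
  rw [Finset.sum_ite_eq]

/-- **`latticeE3` of a preimage triple is `latticeE3` under the push-forward weight.** [this work] -/
theorem latticeE3_preim (μ : α → ℝ) (G : α → γ) (V A B : Finset γ) :
    latticeE3 μ (preim G V) (preim G A) (preim G B) = latticeE3 (pushWeight μ G) V A B := by
  have hu : mass μ (univ : Finset α) = mass (pushWeight μ G) univ := by rw [← preim_univ G, mass_preim]
  unfold latticeE3
  simp only [← preim_inter, mass_preim, hu]

omit [DecidableEq α] [Fintype γ] in
/-- Preimages of up-sets under monotone maps are up-sets. [folklore] -/
theorem isUpperSet_preim [Preorder α] [Preorder γ] {G : α → γ} (hG : Monotone G) {S : Finset γ}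
    (hS : IsUpperSet (S : Set γ)) : IsUpperSet ((preim G S : Finset α) : Set α) := by
  intro x y hxy hx
  rw [Finset.mem_coe, mem_preim] at hx ⊢
  exact hS (hG hxy) hx

end Transfer

/-! ### Locality along a lattice quotient -/

section Quotient

variable {α γ : Type*} [DistribLattice α] [Fintype α] [DecidableEq α] [DecidableLE α]
  [DistribLattice γ] [Fintype γ] [DecidableEq γ]

omit [DecidableEq α] [DecidableLE α] [DistribLattice γ] [Fintype γ] in
/-- A `w`-determined set is the preimage of its image, when the kernel of `G` is agreement below `w`. [this work] -/
theorem preim_image_of_determined {G : α → γ} {w : α} (hw : ∀ x y, G x = G y ↔ x ⊓ w = y ⊓ w) {S : Finset α}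
    (hS : ∀ x, x ∈ S ↔ x ⊓ w ∈ S) : preim G (S.image G) = S := by
  ext x
  rw [mem_preim, Finset.mem_image]
  constructor
  · rintro ⟨s, hs, hsx⟩
    have h1 : s ⊓ w ∈ S := (hS s).1 hs
    rw [(hw s x).1 hsx] at h1
    exact (hS x).2 h1
  · intro hx
    exact ⟨x, hx, rfl⟩

omit [Fintype α] [DecidableEq α] [DecidableLE α] [Fintype γ] in
/-- The image of an up-set under a surjective `⊔`-preserving map is an up-set. [this work] -/
theorem isUpperSet_image {G : α → γ} (hsup : ∀ a b, G (a ⊔ b) = G a ⊔ G b) (hGs : Function.Surjective G)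
    {S : Finset α} (hS : IsUpperSet (S : Set α)) : IsUpperSet ((S.image G : Finset γ) : Set γ) := by
  intro c c' hcc' hc
  rw [Finset.mem_coe, Finset.mem_image] at hc ⊢
  obtain ⟨s, hs, rfl⟩ := hc
  obtain ⟨x', rfl⟩ := hGs c'
  refine ⟨s ⊔ x', hS (le_sup_left : s ≤ s ⊔ x') hs, ?_⟩
  rw [hsup, sup_eq_right.2 hcc']

/-- **Locality along a lattice quotient.**  `G : α → γ` surjective, preserving `⊓` and `⊔`, with kernel "agreement below `w`";
`μ ≥ 0` log-supermodular on `α`; Sahi's `C₃` (indicator form) holds on `γ` under the push-forward weight `G_* μ`.  Then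
`0 ≤ latticeE3 μ U A B` for all up-sets `U, A, B` of `α` with `A ∩ B` `w`-determined. [this work] -/
theorem latticeE3_nonneg_of_inter_determined_of_quotient {μ : α → ℝ} (hμ₀ : 0 ≤ μ)
    (hμ : ∀ a b, μ a * μ b ≤ μ (a ⊓ b) * μ (a ⊔ b)) (G : α → γ) (hsup : ∀ a b, G (a ⊔ b) = G a ⊔ G b)
    (hGs : Function.Surjective G) (w : α) (hw : ∀ x y, G x = G y ↔ x ⊓ w = y ⊓ w)
    (hC3 : ∀ V A' B' : Finset γ, IsUpperSet (V : Set γ) → IsUpperSet (A' : Set γ) → IsUpperSet (B' : Set γ) →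
      0 ≤ latticeE3 (pushWeight μ G) V A' B')
    {U A B : Finset α} (hU : IsUpperSet (U : Set α)) (hA : IsUpperSet (A : Set α)) (hB : IsUpperSet (B : Set α))
    (hK : ∀ x, x ∈ A ∩ B ↔ x ⊓ w ∈ A ∩ B) : 0 ≤ latticeE3 μ U A B := by
  refine latticeE3_nonneg_of_inter_determined_of_cylinders hμ₀ hμ w ?_ hU hA hB hK
  intro V A' B' hV hA' hB' hVw hA'w hB'w
  rw [← preim_image_of_determined hw hVw, ← preim_image_of_determined hw hA'w, ← preim_image_of_determined hw hB'w,
    latticeE3_preim]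
  exact hC3 _ _ _ (isUpperSet_image hsup hGs hV) (isUpperSet_image hsup hGs hA') (isUpperSet_image hsup hGs hB')

end Quotient

/-! ### The cube class: a pairwise intersection depending on three coordinates -/

section Cube

variable {ι : Type*} [Fintype ι] [DecidableEq ι]

/-- Pointwise order on a cube is decidable. [folklore] -/
instance decLEPiBool : DecidableLE (ι → Bool) := fun f g => inferInstanceAs (Decidable (∀ i, f i ≤ g i))

/-- The indicator configuration of the coordinates `e 0, e 1, e 2`. [this work] -/
def blockCfg (e : Fin 3 → ι) : ι → Bool := fun i => decide (∃ j, e j = i)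

omit [Fintype ι] [DecidableEq ι] in
/-- On a cube, `(x ⊓ y) i = (x i && y i)`. [folklore] -/
theorem inf_apply_bool (x y : ι → Bool) (i : ι) : (x ⊓ y) i = (x i && y i) := rfl

omit [Fintype ι] in
/-- Agreement on the coordinates `e` is agreement below the block configuration. [this work] -/
theorem restrict_eq_iff (e : Fin 3 → ι) (x y : ι → Bool) :
    x ∘ e = y ∘ e ↔ x ⊓ blockCfg e = y ⊓ blockCfg e := by
  constructor
  · intro h
    funext i
    rw [inf_apply_bool, inf_apply_bool]
    by_cases hi : ∃ j, e j = i
    · obtain ⟨j, rfl⟩ := hi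
      have hj : x (e j) = y (e j) := congrFun h j
      rw [hj]
    · have hw : blockCfg e i = false := by simp [blockCfg, hi]
      rw [hw, Bool.and_false, Bool.and_false]
  · intro h
    funext j
    have hi : blockCfg e (e j) = true := by
      simp only [blockCfg, decide_eq_true_eq]
      exact ⟨j, rfl⟩
    have h1 := congrFun h (e j)
    rw [inf_apply_bool, inf_apply_bool, hi, Bool.and_true, Bool.and_true] at h1
    exact h1

/-- **Sahi's `C₃` for every FKG measure on a cube when `A ∩ B` depends on three coordinates.**  `μ ≥ 0` log-supermodular on
`ι → Bool`, `U, A, B` up-sets, `e : Fin 3 → ι` injective with membership in `A ∩ B` depending only on the coordinates `e j`: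
`0 ≤ latticeE3 μ U A B`. [this work] -/
theorem latticeE3_nonneg_cube_of_inter_determined_three {μ : (ι → Bool) → ℝ} (hμ₀ : 0 ≤ μ)
    (hμ : ∀ a b, μ a * μ b ≤ μ (a ⊓ b) * μ (a ⊔ b)) {e : Fin 3 → ι} (he : Function.Injective e)
    {U A B : Finset (ι → Bool)} (hU : IsUpperSet (U : Set (ι → Bool))) (hA : IsUpperSet (A : Set (ι → Bool)))
    (hB : IsUpperSet (B : Set (ι → Bool)))
    (hK : ∀ x y : ι → Bool, x ∘ e = y ∘ e → (x ∈ A ∩ B ↔ y ∈ A ∩ B)) : 0 ≤ latticeE3 μ U A B := by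
  let G : (ι → Bool) → (Fin 3 → Bool) := fun x => x ∘ e
  have hsup : ∀ a b : ι → Bool, G (a ⊔ b) = G a ⊔ G b := fun _ _ => rfl
  have hinf : ∀ a b : ι → Bool, G (a ⊓ b) = G a ⊓ G b := fun _ _ => rfl
  have hGs : Function.Surjective G := he.surjective_comp_right
  have hw : ∀ x y : ι → Bool, G x = G y ↔ x ⊓ blockCfg e = y ⊓ blockCfg e := fun x y => restrict_eq_iff e x y
  refine latticeE3_nonneg_of_inter_determined_of_quotient hμ₀ hμ G hsup hGs (blockCfg e) hw ?_ hU hA hB ?_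
  · intro V A' B' hV hA' hB'
    exact SahiC3Cube.latticeE3_nonneg_cube_three (fun c => pushWeight_nonneg (fun b => hμ₀ b) G c)
      (fkgCondition_pushWeight (fun b => hμ₀ b) hμ hinf hsup) hV hA' hB'
  · intro x
    refine hK x (x ⊓ blockCfg e) ((hw x _).2 ?_)
    rw [inf_assoc, inf_idem]

/-- The same class with the constrained intersection formed by the first two slots. [this work] -/
theorem latticeE3_nonneg_cube_of_inter_determined_three₁₂ {μ : (ι → Bool) → ℝ} (hμ₀ : 0 ≤ μ)
    (hμ : ∀ a b, μ a * μ b ≤ μ (a ⊓ b) * μ (a ⊔ b)) {e : Fin 3 → ι} (he : Function.Injective e)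
    {U A B : Finset (ι → Bool)} (hU : IsUpperSet (U : Set (ι → Bool))) (hA : IsUpperSet (A : Set (ι → Bool)))
    (hB : IsUpperSet (B : Set (ι → Bool)))
    (hK : ∀ x y : ι → Bool, x ∘ e = y ∘ e → (x ∈ U ∩ A ↔ y ∈ U ∩ A)) : 0 ≤ latticeE3 μ U A B := by
  rw [latticeE3_comm₂₃, latticeE3_comm₁₂]
  exact latticeE3_nonneg_cube_of_inter_determined_three hμ₀ hμ he hB hU hA hK

/-- The same class with the constrained intersection formed by the first and third slots. [this work] -/
theorem latticeE3_nonneg_cube_of_inter_determined_three₁₃ {μ : (ι → Bool) → ℝ} (hμ₀ : 0 ≤ μ)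
    (hμ : ∀ a b, μ a * μ b ≤ μ (a ⊓ b) * μ (a ⊔ b)) {e : Fin 3 → ι} (he : Function.Injective e)
    {U A B : Finset (ι → Bool)} (hU : IsUpperSet (U : Set (ι → Bool))) (hA : IsUpperSet (A : Set (ι → Bool)))
    (hB : IsUpperSet (B : Set (ι → Bool)))
    (hK : ∀ x y : ι → Bool, x ∘ e = y ∘ e → (x ∈ U ∩ B ↔ y ∈ U ∩ B)) : 0 ≤ latticeE3 μ U A B := by
  rw [latticeE3_comm₁₂]
  exact latticeE3_nonneg_cube_of_inter_determined_three hμ₀ hμ he hA hU hB hK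

end Cube

/-! ### A nonnegative monotone function in the free slot -/

section Fun

open SahiC3Cube (latticeE3fun ind latticeE3fun_indicator latticeE3fun_eq_sum_slotWeight sum_mul_nonneg_of_upperSet slotWeight)

variable {α : Type*} [Fintype α] [DecidableEq α]

/-- **First-slot layer cake**: if `latticeE3 μ U A B ≥ 0` for every up-set `U`, then `latticeE3fun μ u 1_A 1_B ≥ 0` for every
nonnegative monotone `u` (trilinearity; a nonnegative monotone function on a finite preorder is a nonnegative combination of up-set
indicators). [this work] -/
theorem latticeE3fun_nonneg_of_forall_upperSet₁ [Preorder α] {μ : α → ℝ} {A B : Finset α}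
    (h : ∀ U : Finset α, IsUpperSet (U : Set α) → 0 ≤ latticeE3 μ U A B) {u : α → ℝ} (hu : Monotone u)
    (hu0 : ∀ x, 0 ≤ u x) : 0 ≤ latticeE3fun μ u (ind A) (ind B) := by
  rw [latticeE3fun_eq_sum_slotWeight]
  refine sum_mul_nonneg_of_upperSet _ (fun U hU => ?_) u hu hu0
  have hUAB := h U hU
  rw [← latticeE3fun_indicator, latticeE3fun_eq_sum_slotWeight] at hUAB
  have e : ∑ x, slotWeight μ (ind A) (ind B) x * ind U x = ∑ x ∈ U, slotWeight μ (ind A) (ind B) x := by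
    unfold ind; simp only [mul_ite, mul_one, mul_zero]; rw [Finset.sum_ite_mem, Finset.univ_inter]
  rwa [e] at hUAB

/-- **Locality in the intersection, function form**: `μ ≥ 0` log-supermodular on a finite distributive lattice, `u ≥ 0` monotone,
`A, B` up-sets with `A ∩ B` `w`-determined, and Sahi's `C₃` for the `w`-cylinder triples `(V, A*, B*)`; then
`0 ≤ latticeE3fun μ u 1_A 1_B` (`= Z³·E₃(u, 1_A, 1_B)`). [this work] -/
theorem latticeE3fun_nonneg_of_inter_determined [DistribLattice α] [DecidableLE α] {μ : α → ℝ} (hμ₀ : 0 ≤ μ)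
    (hμ : ∀ a b, μ a * μ b ≤ μ (a ⊓ b) * μ (a ⊔ b)) {u : α → ℝ} (hu : Monotone u) (hu0 : ∀ x, 0 ≤ u x)
    {A B : Finset α} (hA : IsUpperSet (A : Set α)) (hB : IsUpperSet (B : Set α)) (w : α)
    (hK : ∀ x, x ∈ A ∩ B ↔ x ⊓ w ∈ A ∩ B)
    (hblock : ∀ V : Finset α, IsUpperSet (V : Set α) → (∀ x, x ∈ V ↔ x ⊓ w ∈ V) →
      0 ≤ latticeE3 μ V (SahiE3PrincipalMeetFKG.starUp A w) (SahiE3PrincipalMeetFKG.starUp B w)) :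
    0 ≤ latticeE3fun μ u (ind A) (ind B) :=
  latticeE3fun_nonneg_of_forall_upperSet₁
    (fun _ hU => latticeE3_nonneg_of_inter_determined hμ₀ hμ hU hA hB w hK hblock) hu hu0

end Fun

section FunCube

open SahiC3Cube (latticeE3fun ind)

variable {ι : Type*} [Fintype ι] [DecidableEq ι]

/-- **The cube class, function form**: for every nonnegative log-supermodular weight on `ι → Bool`, every nonnegative monotone `u`
and up-sets `A, B` whose intersection depends on three coordinates `e : Fin 3 → ι`: `0 ≤ latticeE3fun μ u 1_A 1_B`. [this work] -/
theorem latticeE3fun_nonneg_cube_of_inter_determined_three {μ : (ι → Bool) → ℝ} (hμ₀ : 0 ≤ μ)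
    (hμ : ∀ a b, μ a * μ b ≤ μ (a ⊓ b) * μ (a ⊔ b)) {e : Fin 3 → ι} (he : Function.Injective e)
    {u : (ι → Bool) → ℝ} (hu : Monotone u) (hu0 : ∀ x, 0 ≤ u x)
    {A B : Finset (ι → Bool)} (hA : IsUpperSet (A : Set (ι → Bool))) (hB : IsUpperSet (B : Set (ι → Bool)))
    (hK : ∀ x y : ι → Bool, x ∘ e = y ∘ e → (x ∈ A ∩ B ↔ y ∈ A ∩ B)) : 0 ≤ latticeE3fun μ u (ind A) (ind B) :=
  latticeE3fun_nonneg_of_forall_upperSet₁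
    (fun _ hU => latticeE3_nonneg_cube_of_inter_determined_three hμ₀ hμ he hU hA hB hK) hu hu0

end FunCube

/-! ### In the vocabulary of `SahiConjecture 3`: the Literature functional `sahiE μ 3` for FKG probability weights -/

section Sahi

open SahiC3Cube (latticeE3fun ind)
open Literature.Combinatorics.Sahi2008 (ex sahiE sahiE_three IsFKGMeasure)

variable {α : Type*} [Fintype α] [DecidableEq α]

omit [DecidableEq α] in
/-- For a probability weight the homogeneous functional IS Sahi's `E₃`: `latticeE3fun μ f g h = sahiE μ 3 ![f, g, h]`. [this work] -/
theorem latticeE3fun_eq_sahiE_three {μ : α → ℝ} (hμ1 : ∑ x, μ x = 1) (f g h : α → ℝ) :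
    latticeE3fun μ f g h = sahiE μ 3 ![f, g, h] := by
  rw [sahiE_three]
  unfold latticeE3fun ex
  rw [hμ1]
  simp only [Pi.mul_apply]
  ring

/-- **Sahi's `E₃(u, 1_A, 1_B) ≥ 0` for every FKG probability weight on a finite distributive lattice** when `A ∩ B` is `w`-determined and
the `w`-cylinder triples `(V, A*, B*)` satisfy `C₃` (e.g. `A ∩ B` principal, `w = c`): the `n = 3` functional of
`SahiConjecture`, with one monotone nonnegative function and two increasing events. [this work] -/
theorem sahiE_three_nonneg_of_inter_determined [DistribLattice α] [DecidableLE α] {μ : α → ℝ} (hμ : IsFKGMeasure μ)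
    {u : α → ℝ} (hu : Monotone u) (hu0 : ∀ x, 0 ≤ u x) {A B : Finset α} (hA : IsUpperSet (A : Set α))
    (hB : IsUpperSet (B : Set α)) (w : α) (hK : ∀ x, x ∈ A ∩ B ↔ x ⊓ w ∈ A ∩ B)
    (hblock : ∀ V : Finset α, IsUpperSet (V : Set α) → (∀ x, x ∈ V ↔ x ⊓ w ∈ V) →
      0 ≤ latticeE3 μ V (SahiE3PrincipalMeetFKG.starUp A w) (SahiE3PrincipalMeetFKG.starUp B w)) :
    0 ≤ sahiE μ 3 ![u, ind A, ind B] := by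
  rw [← latticeE3fun_eq_sahiE_three hμ.sum_eq_one]
  exact latticeE3fun_nonneg_of_inter_determined (fun x => hμ.nonneg x) hμ.mul_le_mul hu hu0 hA hB w hK hblock

end Sahi

section SahiCube

open SahiC3Cube (latticeE3fun ind)
open Literature.Combinatorics.Sahi2008 (sahiE IsFKGMeasure)

variable {ι : Type*} [Fintype ι] [DecidableEq ι]

/-- **Sahi's `E₃(u, 1_A, 1_B) ≥ 0` for every FKG probability weight on a cube `ι → Bool`** when membership in `A ∩ B` depends on three
coordinates: an unconditional instance of `SahiConjecture 3` beyond `|X| ≤ 2` [Sahi2008, Prop. 15] and the principal-slot class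
[Sahi2008, Thm. 2; Blinovsky 2013]. [this work] -/
theorem sahiE_three_nonneg_cube_of_inter_determined_three {μ : (ι → Bool) → ℝ} (hμ : IsFKGMeasure μ)
    {e : Fin 3 → ι} (he : Function.Injective e) {u : (ι → Bool) → ℝ} (hu : Monotone u) (hu0 : ∀ x, 0 ≤ u x)
    {A B : Finset (ι → Bool)} (hA : IsUpperSet (A : Set (ι → Bool))) (hB : IsUpperSet (B : Set (ι → Bool)))
    (hK : ∀ x y : ι → Bool, x ∘ e = y ∘ e → (x ∈ A ∩ B ↔ y ∈ A ∩ B)) : 0 ≤ sahiE μ 3 ![u, ind A, ind B] := by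
  rw [← latticeE3fun_eq_sahiE_three hμ.sum_eq_one]
  exact latticeE3fun_nonneg_cube_of_inter_determined_three (fun x => hμ.nonneg x) hμ.mul_le_mul he hu hu0 hA hB hK

end SahiCube

end Summit.CriticalPhenomena.PercolationContinuityZ3.Theorems.SahiE3DeterminedMeetFKG
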